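import Summits.HodgeConjecture.HodgeConjecture.Theorems.VHCAbelianSchemesRoadSecantQuotientAnchorCMOneAnchorMarkman
import Summits.HodgeConjecture.HodgeConjecture.Theorems.Ring2AbelianAllOneAnchorWeilCarrier
import Summits.HodgeConjecture.HodgeConjecture.Theorems.WeilTypeLadderLocalAnchor
import Literature.AlgebraicGeometry.HodgeTheory.AmpleDivisorClassHyperplaneClass
import Literature.AlgebraicGeometry.Markman2025.SecantQuotientPolarizationDivisor
import HarnessLib

/-!
# Road b02 (`VHCAbelianSchemesRoad`, D-0059) — lane W1 of crux `SemiregularSheafRepresentativesTwAtDiag` (item stmt-HodgeConjecture-19787):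
# THE ONE-ANCHOR JUNCTION AND «L1″ ⟹ NODE» WITHOUT THE HYPERPLANE PIN — the pin, the Kähler multiple, the ample-line clause and
# André's hard-Lefschetz clause of every pinned polarisation `h_Y(θ₀)` are THEOREMS (fact-free; Kodaira's named fact no longer used)

research route conditional on HC_CM; not a corollary; Q11.4-sentence-2 already refuted in dim ≥ 3.

THEOREMS ONLY (no definition, no new named fact; `HC_CM` nowhere; the claim-tagged L1″
`HodgeTheory.Markman2025_secantQuotient_twistedCarrier_onJacobian_pinned` — PREPRINT arXiv:2502.03415, under review — enters as a
HYPOTHESIS by name only). Sequel of `…AnchorCMOneAnchorJunction` (p533669) and `…AnchorCMOneAnchorMarkman` (p536711), which displayed,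
for the pinned polarisation `h_Y(θ₀)` of a secant–quotient datum, a HYPERPLANE-CLASS PIN `∃ e a, e^*a = h_Y(θ₀)` (or Kodaira's named
fact `Kodaira1954_rationalKaehlerClass_eq_hyperplaneClass` + a Kähler real multiple). The typer lemma that discharges it is now in the
tree (`HodgeTheory/AmpleDivisorClassHyperplaneClass`: a non-zero rational class on the line of an AMPLE divisor is `e^*a`, `a`
rational `≠ 0` — Hartshorne II 7.6 + Kobayashi naturality + rationality, no Kodaira — hence has a Kähler real multiple, Voisin I
Thm. 7.10), and the ample divisor itself is in the tree (`Markman2025.exists_isAmple_isPolarizationClassOf_secantPolarizationClass`: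
`h_Y(θ₀) ∈ ℚˣ·[r_q^*E]`). This file composes them:

* §1 for EVERY datum `D` and EVERY polarisation class `θ₀` of `Θ`: `h_Y(θ₀)` is on the line of an ample divisor of `Y`
  (`SecantQuotientDatum.exists_isAmple_isPolarizationClassOf_hY`), is a polarisation class in André's sense in dimension `6`
  (`isPolarizationClass_hY`), is a hyperplane class `e^*a` (`exists_projectiveEmbedding_map_eq_hY`) and has a Kähler real
  multiple (`exists_isKaehlerClass_smul_hY`); hence the displayed hypotheses `hpin` of
  `oneHyperbolicWeilCarrier_of_markmanPinned_of_hyperplanePin` and `hKm` of `…_of_kodaira` HOLD (`hyperplanePins_hY`,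
  `kaehlerMultiples_hY`);
* §2 the junction with three hypotheses fewer: **`SecantQuotientDatum.oneHyperbolicWeilCarrier_of_anchoredCarrierAt_pinned`** —
  `AnchoredCarrierAt 𝒪 6 3 𝔄^pin 𝔖^pin` (2a″'s body) at ONE pinned anchor `(Y_d, h_Y(θ₀), γ)` ⟹ `OneHyperbolicWeilCarrier 𝒪 3 ((d+1)²·d)`,
  inputs `hθ₀, hW, hγQ, hray, hmem` only (`hpol`, `hamp`, `hea` derived); the every-copy-datum form
  `oneHyperbolicWeilCarrier_of_copyDatum_pinned`; twisted ∀`C` form;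
* §3 **`oneHyperbolicWeilCarrier_of_markmanPinned : L1″(C, Adm) → ∀ even d ≥ 4, OneHyperbolicWeilCarrier (twistedReflexiveClass C Adm) 3 ((d+1)²·d)`**
  — PRINT'S PINNED CLAIM ALONE ⟹ THE ANDRÉ COLUMN'S ONE-ANCHOR NODE, every even `d ≥ 4` (every imaginary quadratic field:
  `d = 4m`); twisted ∀`C` form `oneHyperbolicWeilTwistedCarrier_of_markmanPinned`;
* §4 DOWNSTREAM, composed here by name (the same one-liner as the leaf file `Ring2AbelianAllOneAnchorWeilCarrierRows` §1, which is not
  imported): **`weilClasses_algebraic_hyperbolic_of_reach_of_door_of_markmanPinned`** — L1″ ∧ door (`LocalVariationalHodgeFor (twistedReflexiveClass C Adm)`)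
  ∧ reach (`weilFamilyReach_hyperbolic`) ⟹ the Weil plane of EVERY hyperbolic `(A, φ, h_K(e_A, a_A))` of dimension `6` with `φ² = −(d+1)²d`
  is algebraic (`d` even `≥ 4`; `d = 4m` covers every imaginary quadratic field) — «L1″ ∧ door ∧ reach ⟹ Markman's Thm. 1.5.1 on these
  hyperbolic components», each input BY NAME, no pin, no Kodaira; twisted-door (`TwistedPerfectDoorVHC C Adm`) and road-binder
  (`TwistedPerfectDoor`, `ChernCharacterOnBetti`) forms.

HONEST: nothing here says L1″, 2a″, the node, the door, reach, any cell, K-SR♭∃, VHC, `HC_AV`, `HC_CM` or HC holds; no object-level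
carrier is constructed.

References: [cite: Markman2025SecantWeil, §1.5 (p. 7), Thm. 1.4.1, Thm. 1.5.1 and §9.3 Lemma 9.3.11] [cite: Hartshorne1977, II Thm. 7.6 (p. 154)]
[cite: VoisinHodgeI2002, §3.3.2 Lemma 3.16, Thm. 6.25, §7.1.2 Thm. 7.10] [cite: vanGeemen1994HodgeAV, Lemma 5.2, 5.4 and proof of Thm. 6.12]
[cite: Bloch1972Semiregularity, Remark (7.5)] [cite: MumfordAV1970, §19 (Remark p. 169)].
-/

noncomputable section

open CategoryTheory CategoryTheory.Limits AlgebraicGeometry Topology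

namespace Summit.HodgeConjecture.HodgeConjecture.Ring2.SemiregularRepresentatives

set_option linter.dupNamespace false -- the cell's namespace repeats the summit name, as in every `Ring2*` file

open Literature.AlgebraicGeometry Literature.AlgebraicGeometry.Motives Literature.AlgebraicGeometry.Motives.AbelianVariety
open Literature.AlgebraicGeometry.HodgeTheory Literature.AlgebraicGeometry.Markman2025
open Literature.AlgebraicTopology.SingularHomology
open Summit.Ventures.HSemireg (ObjClass LocalVariationalHodgeFor)
open Summit.HodgeConjecture.HodgeConjecture.Ring2.AbelianAll (hyperbolicAnchorChart hyperbolicAnchorServed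
  OneHyperbolicWeilCarrier OneHyperbolicWeilTwistedCarrier)

/-! ## §1 Every pinned polarisation `h_Y(θ₀)` is an ample-line class, a polarisation class, a hyperplane class, with a Kähler multiple -/

namespace SecantQuotientDatum

variable (D : SecantQuotientDatum)

/-- **`h_Y(θ₀)` lies on the line of an AMPLE divisor of `Y`** for every polarisation class `θ₀ ∈ ℚˣ·[Θ]`: the ample-line clause of
the pinned anchor predicate HOLDS for every datum (`H = r_q^*(p₁^*(m²Θ) + p₂^*g^*(dΘ))`,
`Markman2025.exists_isAmple_isPolarizationClassOf_secantPolarizationClass`; «`Ξ` descends to an ample class `h` on `Y`»).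
[cite: Markman2025SecantWeil, §1.5 (p. 7) and §9.3 Lemma 9.3.11] [cite: MumfordAV1970, §19 (Remark p. 169)] -/
theorem exists_isAmple_isPolarizationClassOf_hY {θ₀ : complexBetti D.𝒥.J.X 2} (hθ₀ : D.𝒥.J.IsPolarizationClassOf D.Θ θ₀) :
    ∃ H : CartierDivisor D.Y.X.left, H.IsAmple ∧ D.Y.IsPolarizationClassOf H (D.hY θ₀) :=
  exists_isAmple_isPolarizationClassOf_secantPolarizationClass D.𝒥.J D.isAmple D.G₁ D.G₂ D.succ_ne_zero D.G₁_le D.G₂_le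
    (by have := D.four_le; omega) hθ₀

/-- **`h_Y(θ₀)` is a polarisation class of `Y` in André's sense in dimension `6`** (rational, in `N¹H²`, hard Lefschetz): the clause
`IsPolarizationClass 6 Y (h_Y θ₀)` of the pinned anchor predicate HOLDS for every datum. [cite: Markman2025SecantWeil, §1.5 (p. 7)]
[cite: VoisinHodgeI2002, Thm. 6.25 with §7.1.2 Thm. 7.10] -/
theorem isPolarizationClass_hY {θ₀ : complexBetti D.𝒥.J.X 2} (hθ₀ : D.𝒥.J.IsPolarizationClassOf D.Θ θ₀) :
    IsPolarizationClass 6 D.Y.X (D.hY θ₀) := by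
  have h := isPolarizationClass_secantPolarizationClass D.𝒥.J D.isAmple D.G₁ D.G₂ D.succ_ne_zero D.G₁_le D.G₂_le
    (d := D.d) (by have := D.four_le; omega) hθ₀
  change IsPolarizationClass D.Y.dim D.Y.X (D.hY θ₀) at h
  rwa [D.dim_Y] at h

/-- **THE HYPERPLANE PIN IS A THEOREM: `h_Y(θ₀) = e^*a`** for a projective embedding `e : Y ↪ ℙᴺ` and a rational `a ≠ 0`, for every
datum and every polarisation class `θ₀` of `Θ` (ample line §1 + `AbelianVariety.exists_projectiveEmbedding_map_eq_of_ampleLine`: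
Hartshorne II 7.6 on the real carrier; Kodaira's named fact is NOT used). [cite: Hartshorne1977, II Thm. 7.6 (p. 154)]
[cite: VoisinHodgeI2002, §3.3.2 Lemma 3.16 and §7.2.1 Thm. 7.14] [cite: Markman2025SecantWeil, §1.5 (p. 7)] -/
theorem exists_projectiveEmbedding_map_eq_hY {θ₀ : complexBetti D.𝒥.J.X 2} (hθ₀ : D.𝒥.J.IsPolarizationClassOf D.Θ θ₀) :
    ∃ (e : ProjectiveEmbedding D.Y.X) (a : complexBetti (projectiveSpace e.n ℂ) 2),
      IsRationalClass a ∧ a ≠ 0 ∧ complexBetti.map e.ι 2 a = D.hY θ₀ :=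
  AbelianVariety.exists_projectiveEmbedding_map_eq_of_ampleLine D.Y (D.exists_isAmple_isPolarizationClassOf_hY hθ₀)

/-- **`h_Y(θ₀)` has a Kähler REAL multiple** (`∃ s ∈ ℝˣ, IsKaehlerClass 6 Y (s • h_Y θ₀)`; Voisin I Thm. 7.10 for the ample line of §1).
[cite: VoisinHodgeI2002, §7.1.2 Thm. 7.10] [cite: Markman2025SecantWeil, §1.5 (p. 7)] -/
theorem exists_isKaehlerClass_smul_hY {θ₀ : complexBetti D.𝒥.J.X 2} (hθ₀ : D.𝒥.J.IsPolarizationClassOf D.Θ θ₀) :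
    ∃ s : ℝ, s ≠ 0 ∧ IsKaehlerClass 6 D.Y.X ((s : ℂ) • D.hY θ₀) := by
  have h := AbelianVariety.exists_isKaehlerClass_smul_of_ampleLine D.Y (D.exists_isAmple_isPolarizationClassOf_hY hθ₀)
  rwa [D.dim_Y] at h

end SecantQuotientDatum

/-- **The displayed hypothesis `hpin` of `oneHyperbolicWeilCarrier_of_markmanPinned_of_hyperplanePin` (p536711) HOLDS**: hyperplane pins
for every pinned polarisation of every datum (its `IsPolarizationClass` premise is not even needed). [cite: Hartshorne1977, II Thm. 7.6 (p. 154)]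
[cite: Markman2025SecantWeil, §1.5 (p. 7)] -/
theorem hyperplanePins_hY : ∀ (D : SecantQuotientDatum) (θ₀ : complexBetti D.𝒥.J.X 2), D.𝒥.J.IsPolarizationClassOf D.Θ θ₀ →
    IsPolarizationClass 6 D.Y.X (D.hY θ₀) →
    ∃ (e : ProjectiveEmbedding D.Y.X) (a : complexBetti (projectiveSpace e.n ℂ) 2),
      IsRationalClass a ∧ a ≠ 0 ∧ complexBetti.map e.ι 2 a = D.hY θ₀ :=
  fun D _ hθ₀ _ ↦ D.exists_projectiveEmbedding_map_eq_hY hθ₀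

/-- **The displayed hypothesis `hKm` of `oneHyperbolicWeilCarrier_of_markmanPinned_of_kodaira` (p536711) HOLDS**: Kähler real multiples for
every pinned polarisation of every datum. [cite: VoisinHodgeI2002, §7.1.2 Thm. 7.10] [cite: Markman2025SecantWeil, §1.5 (p. 7)] -/
theorem kaehlerMultiples_hY : ∀ (D : SecantQuotientDatum) (θ₀ : complexBetti D.𝒥.J.X 2), D.𝒥.J.IsPolarizationClassOf D.Θ θ₀ →
    ∃ s : ℝ, s ≠ 0 ∧ IsKaehlerClass 6 D.Y.X ((s : ℂ) • D.hY θ₀) :=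
  fun D _ hθ₀ ↦ D.exists_isKaehlerClass_smul_hY hθ₀

/-! ## §2 The one-anchor junction without the pin -/

section Junction

variable {𝒪 : ObjClass}

/-- **2a″ AT ONE PINNED ANCHOR ⟹ THE ONE-ANCHOR WEIL-CARRIER NODE at `(3, (d+1)²·d)`, no pin**: the junction
`SecantQuotientDatum.oneHyperbolicWeilCarrier_of_anchoredCarrierAt_secantQuotientPinned` (p533669) with its hypotheses `hpol`
(André polarisation class), `hamp` (ample line) and `hea` (hyperplane pin) DISCHARGED by §1. Data left: a datum `D`, a polarisation
class `θ₀` of `Θ`, hyperbolicity of `(J × Ĵ, φ_d)` for `Ξ_d(θ₀) = q^*h_Y(θ₀)`, and the class `γ` (rational, off the ray `ℂ·h_Y(θ₀)³`,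
`q^*γ` a Weil class). Node data as there: `P := Y`, `ψ₀ := ψ_Y = r ≫ φ_d ≫ q`, `w := γ`, `h_K = 2(d+1)²d·h_Y(θ₀)`.
[cite: Markman2025SecantWeil, §1.5 (p. 7), Thm. 1.4.1 and Thm. 1.5.1] [cite: vanGeemen1994HodgeAV, Lemma 5.2, 5.4 and proof of Thm. 6.12]
[cite: Hartshorne1977, II Thm. 7.6 (p. 154)] -/
theorem SecantQuotientDatum.oneHyperbolicWeilCarrier_of_anchoredCarrierAt_pinned (D : SecantQuotientDatum)
    (h2a : AnchoredCarrierAt 𝒪 6 3 (fun X θ ↦ secantQuotientAnchorsPinned X θ) (fun X θ ↦ secantQuotientServedClassesPinned X θ))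
    {θ₀ : complexBetti D.𝒥.J.X 2} (hθ₀ : D.𝒥.J.IsPolarizationClassOf D.Θ θ₀) {γ : complexBetti D.Y.X (2 * 3)}
    (hW : IsHyperbolicWeilType D.P D.ψ 3 (complexBetti.map D.q.hom.hom.hom 2 (D.hY θ₀)))
    (hγQ : IsRationalClass γ) (hray : γ ∉ (ℂ ∙ cupPowTwo (D.hY θ₀) 3))
    (hmem : complexBetti.map D.q.hom.hom.hom (2 * 3) γ ∈ weilClassesOf D.P D.ψ 3 D.d) :
    OneHyperbolicWeilCarrier 𝒪 3 ((D.d + 1) ^ 2 * D.d) :=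
  D.oneHyperbolicWeilCarrier_of_anchoredCarrierAt_secantQuotientPinned h2a hθ₀ (D.isPolarizationClass_hY hθ₀)
    (D.exists_isAmple_isPolarizationClassOf_hY hθ₀) hW hγQ hray hmem (D.exists_projectiveEmbedding_map_eq_hY hθ₀)

/-- **Twisted door, every `C`, no pin: the stub 2a″ (`∀ C, SecantQuotientAnchorCarrier63Pinned C`) at one pinned anchor ⟹
`OneHyperbolicWeilTwistedCarrier 3 ((d+1)²·d)`.** [cite: Markman2025SecantWeil, Thm. 1.4.1, §1.5 and §7.3] [cite: Bloch1972Semiregularity, Remark (7.5)] -/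
theorem SecantQuotientDatum.oneHyperbolicWeilTwistedCarrier_of_secantQuotientAnchorCarrier63Pinned_pinned (D : SecantQuotientDatum)
    (h2a : ∀ C : ChernCharacterBetti, SecantQuotientAnchorCarrier63Pinned C)
    {θ₀ : complexBetti D.𝒥.J.X 2} (hθ₀ : D.𝒥.J.IsPolarizationClassOf D.Θ θ₀) {γ : complexBetti D.Y.X (2 * 3)}
    (hW : IsHyperbolicWeilType D.P D.ψ 3 (complexBetti.map D.q.hom.hom.hom 2 (D.hY θ₀)))
    (hγQ : IsRationalClass γ) (hray : γ ∉ (ℂ ∙ cupPowTwo (D.hY θ₀) 3))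
    (hmem : complexBetti.map D.q.hom.hom.hom (2 * 3) γ ∈ weilClassesOf D.P D.ψ 3 D.d) :
    OneHyperbolicWeilTwistedCarrier 3 ((D.d + 1) ^ 2 * D.d) :=
  fun C ↦ D.oneHyperbolicWeilCarrier_of_anchoredCarrierAt_pinned (h2a C) hθ₀ hW hγQ hray hmem

/-- **The one-anchor node from an every-copy datum, no pin**: `SecantQuotientDatum.oneHyperbolicWeilCarrier_of_copyDatum` (p536711) with
`hea` discharged by §1 — on every copy `e : X' ≅ Y` an `𝒪`-datum with `κ₃ = e^*γ + c₃·(e^*h_Y(θ₀))³`, sides on the ray, suffices.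
[cite: Markman2025SecantWeil, §1.5 (p. 7), Thm. 1.4.1 and Thm. 1.5.1] [cite: Bloch1972Semiregularity, Remark (7.5)] -/
theorem SecantQuotientDatum.oneHyperbolicWeilCarrier_of_copyDatum_pinned (D : SecantQuotientDatum)
    {θ₀ : complexBetti D.𝒥.J.X 2} (hθ₀ : D.𝒥.J.IsPolarizationClassOf D.Θ θ₀) {γ : complexBetti D.Y.X (2 * 3)}
    (hcopy : ∀ (X' : SchemeOver ℂ) (e : X' ≅ D.Y.X),
      ∃ (I : Finset ℕ) (κ : (k : ℕ) → complexBetti X' (2 * k)) (c : ℕ → ℂ),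
        3 ∈ I ∧ 𝒪 6 X' I κ ∧
        κ 3 = complexBetti.map e.hom (2 * 3) γ + c 3 • cupPowTwo (complexBetti.map e.hom 2 (D.hY θ₀)) 3 ∧
        ∀ k ∈ I, k ≠ 3 → κ k = c k • cupPowTwo (complexBetti.map e.hom 2 (D.hY θ₀)) k)
    (hW : IsHyperbolicWeilType D.P D.ψ 3 (complexBetti.map D.q.hom.hom.hom 2 (D.hY θ₀)))
    (hγQ : IsRationalClass γ) (hray : γ ∉ (ℂ ∙ cupPowTwo (D.hY θ₀) 3))
    (hmem : complexBetti.map D.q.hom.hom.hom (2 * 3) γ ∈ weilClassesOf D.P D.ψ 3 D.d) :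
    OneHyperbolicWeilCarrier 𝒪 3 ((D.d + 1) ^ 2 * D.d) :=
  D.oneHyperbolicWeilCarrier_of_copyDatum hcopy hW hγQ hray hmem (D.exists_projectiveEmbedding_map_eq_hY hθ₀)

end Junction

/-! ## §3 L1″ ⟹ the one-anchor node, unconditionally in the pin -/

section Markman

/-- **PRINT'S PINNED CLAIM L1″ ⟹ THE ONE-ANCHOR NODE, per `C` and `Adm`, for every even `d ≥ 4` — NO PIN HYPOTHESIS**:
`Markman2025_secantQuotient_twistedCarrier_onJacobian_pinned C Adm ⟹ OneHyperbolicWeilCarrier (twistedReflexiveClass C Adm) 3 ((d+1)²·d)`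
(p536711's `oneHyperbolicWeilCarrier_of_markmanPinned_of_hyperplanePin` with `hpin := hyperplanePins_hY`). The first UNCONDITIONAL kernel edge
(in everything but L1″ itself) from the road's object-level preprint claim to the André ∕ Weil-ladder column's smallest node; with door ∧
reach the Rows file turns the node into the algebraicity of the Weil plane of every hyperbolic `(A, φ, h)` of dimension `6` with
`φ² = −(d+1)²d` (`d = 4m` covers every imaginary quadratic field). Nothing here says L1″, the node or the door holds.
[cite: Markman2025SecantWeil, Thm. 1.4.1, §1.5 and Thm. 1.5.1] [cite: vanGeemen1994HodgeAV, proof of Thm. 6.12] [cite: Hartshorne1977, II Thm. 7.6 (p. 154)] -/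
theorem oneHyperbolicWeilCarrier_of_markmanPinned {C : ChernCharacterBetti} {Adm : PerfectAdmissibility}
    (hM : Markman2025_secantQuotient_twistedCarrier_onJacobian_pinned C Adm) {d : ℕ} (hd : Even d) (h4 : 4 ≤ d) :
    OneHyperbolicWeilCarrier (twistedReflexiveClass C Adm) 3 ((d + 1) ^ 2 * d) :=
  oneHyperbolicWeilCarrier_of_markmanPinned_of_hyperplanePin hM hyperplanePins_hY hd h4

/-- **Twisted door, every `C`, no pin: `(∀ C, L1″ C AdmTw) ⟹ OneHyperbolicWeilTwistedCarrier 3 ((d+1)²·d)`** for every even `d ≥ 4`.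
[cite: Markman2025SecantWeil, Thm. 1.4.1, §1.5 and §7.3] [cite: Bloch1972Semiregularity, Remark (7.5)] -/
theorem oneHyperbolicWeilTwistedCarrier_of_markmanPinned
    (hM : ∀ C : ChernCharacterBetti, Markman2025_secantQuotient_twistedCarrier_onJacobian_pinned C
      (fun n X₀ I E => Summit.Ventures.HSemireg.gluableSigmaAdmissible n X₀ I E ∨
        Literature.AlgebraicGeometry.HodgeTheory.bfSingleAdmissible n X₀ I E))
    {d : ℕ} (hd : Even d) (h4 : 4 ≤ d) :
    OneHyperbolicWeilTwistedCarrier 3 ((d + 1) ^ 2 * d) :=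
  oneHyperbolicWeilTwistedCarrier_of_markmanPinned_of_hyperplanePin hM hyperplanePins_hY hd h4

end Markman

/-! ## §4 Downstream, by name: L1″ ∧ door ∧ reach ⟹ the Weil plane of EVERY hyperbolic sixfold with `φ² = −(d+1)²d` is algebraic -/

section Rows

open Summit.HodgeConjecture.HodgeConjecture.Ring2.AbelianAll (hasLocallyAlgebraicWeilAnchor_of_door_of_oneHyperbolicWeilCarrier
  hasLocallyAlgebraicWeilAnchor_of_twistedPerfectDoorVHC_of_oneHyperbolicWeilCarrier)
open Summit.HodgeConjecture.HodgeConjecture.WeilTypeLadder (weilClasses_algebraic_hyperbolic_of_localAnchor)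

/-- `1 ≤ (d+1)²·d` for `d ≥ 4`. [folklore] -/
private theorem one_le_level {d : ℕ} (h4 : 4 ≤ d) : 1 ≤ (d + 1) ^ 2 * d :=
  Nat.mul_pos (pow_pos (Nat.succ_pos d) 2) (by omega)

/-- **L1″ ∧ DOOR ∧ REACH ⟹ THE WEIL PLANE OF EVERY HYPERBOLIC `ℚ(√−d')`-SIXFOLD WITH `d' = (d+1)²·d` IS ALGEBRAIC** (`d` even `≥ 4`; `d' ∈ d·(ℚˣ)²`,
so `d = 4m` reaches every imaginary quadratic field): for every abelian sixfold `A` with `φ ≫ φ = −d'`, every hyperplane class `e_A^*a_A`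
(`a_A` rational `≠ 0`) making `(A, φ)` hyperbolic for `h_K = d'·e_A^*a_A + φ^*e_A^*a_A`, `weilClassesOf A φ 3 d' ≤ algebraicClasses A 3`.
Inputs BY NAME: print's pinned claim L1″ (`Markman2025_secantQuotient_twistedCarrier_onJacobian_pinned C Adm`, preprint), the door for the
twisted reflexive class (`LocalVariationalHodgeFor (twistedReflexiveClass C Adm)`), Deligne's family with reach (`weilFamilyReach_hyperbolic`);
composition: §3's node ⟹ a locally algebraic anchor (`AbelianAll.hasLocallyAlgebraicWeilAnchor_of_door_of_oneHyperbolicWeilCarrier`, PART AC-e)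
⟹ every hyperbolic member (`WeilTypeLadder.weilClasses_algebraic_hyperbolic_of_localAnchor`). This is the kernel's rendering of Markman's
Thm. 1.5.1 on the hyperbolic components in the road's currency, with no pin and no Kodaira; nothing here says L1″, the door or reach holds.
[cite: Markman2025SecantWeil, Thm. 1.4.1, §1.5 (p. 7) and Thm. 1.5.1 (§9.3)] [cite: Deligne1982HodgeCycles, §4 proof of Thm. 4.8]
[cite: vanGeemen1994HodgeAV, proof of Thm. 6.12] [cite: BuchweitzFlenner2003, §5 Thm. 5.1] -/
theorem weilClasses_algebraic_hyperbolic_of_reach_of_door_of_markmanPinned {C : ChernCharacterBetti} {Adm : PerfectAdmissibility}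
    (hM : Markman2025_secantQuotient_twistedCarrier_onJacobian_pinned C Adm)
    (hT : LocalVariationalHodgeFor (twistedReflexiveClass C Adm)) (hF : weilFamilyReach_hyperbolic)
    {d : ℕ} (hd : Even d) (h4 : 4 ≤ d)
    (A : AbelianVariety ℂ) (φ : A ⟶ A) (hA : A.dim = 2 * 3) (hφ : φ ≫ φ = -(((d + 1) ^ 2 * d) • 𝟙 A))
    (eA : ProjectiveEmbedding A.X) (aA : complexBetti (projectiveSpace eA.n ℂ) 2) (haA : IsRationalClass aA) (haA0 : aA ≠ 0)
    (hhypA : IsHyperbolicWeilType A φ 3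
      ((((d + 1) ^ 2 * d : ℕ) : ℂ) • complexBetti.map eA.ι 2 aA + complexBetti.map φ.hom.hom.hom 2 (complexBetti.map eA.ι 2 aA))) :
    weilClassesOf A φ 3 ((d + 1) ^ 2 * d) ≤ algebraicClasses A.X 3 :=
  weilClasses_algebraic_hyperbolic_of_localAnchor 3 ((d + 1) ^ 2 * d) (by norm_num) (one_le_level h4)
    (hasLocallyAlgebraicWeilAnchor_of_door_of_oneHyperbolicWeilCarrier hT (oneHyperbolicWeilCarrier_of_markmanPinned hM hd h4))
    hF A φ hA hφ eA aA haA haA0 hhypA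

/-- **Twisted-door form, route binder by name per `C`**: L1″(`C`, `Adm`) ∧ `TwistedPerfectDoorVHC C Adm` ∧ reach ⟹ the Weil plane of every
hyperbolic sixfold with `φ² = −(d+1)²d` is algebraic (`d` even `≥ 4`). [cite: Markman2025SecantWeil, Thm. 1.4.1, §1.5 and Thm. 1.5.1]
[cite: Deligne1982HodgeCycles, §4 proof of Thm. 4.8] [cite: Bloch1972Semiregularity, Remark (7.5)] -/
theorem weilClasses_algebraic_hyperbolic_of_reach_of_twistedPerfectDoorVHC_of_markmanPinned {C : ChernCharacterBetti}
    {Adm : PerfectAdmissibility} (hM : Markman2025_secantQuotient_twistedCarrier_onJacobian_pinned C Adm)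
    (hDoor : TwistedPerfectDoorVHC C Adm) (hF : weilFamilyReach_hyperbolic) {d : ℕ} (hd : Even d) (h4 : 4 ≤ d)
    (A : AbelianVariety ℂ) (φ : A ⟶ A) (hA : A.dim = 2 * 3) (hφ : φ ≫ φ = -(((d + 1) ^ 2 * d) • 𝟙 A))
    (eA : ProjectiveEmbedding A.X) (aA : complexBetti (projectiveSpace eA.n ℂ) 2) (haA : IsRationalClass aA) (haA0 : aA ≠ 0)
    (hhypA : IsHyperbolicWeilType A φ 3
      ((((d + 1) ^ 2 * d : ℕ) : ℂ) • complexBetti.map eA.ι 2 aA + complexBetti.map φ.hom.hom.hom 2 (complexBetti.map eA.ι 2 aA))) :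
    weilClassesOf A φ 3 ((d + 1) ^ 2 * d) ≤ algebraicClasses A.X 3 :=
  weilClasses_algebraic_hyperbolic_of_localAnchor 3 ((d + 1) ^ 2 * d) (by norm_num) (one_le_level h4)
    (hasLocallyAlgebraicWeilAnchor_of_twistedPerfectDoorVHC_of_oneHyperbolicWeilCarrier hDoor
      (oneHyperbolicWeilCarrier_of_markmanPinned hM hd h4))
    hF A φ hA hφ eA aA haA haA0 hhypA

/-- **Road-binder form**: `(∀ C, L1″ C AdmTw)` ∧ K-C (`VHCAbelianSchemesRoad.ChernCharacterOnBetti`, to pick a Chern character) ∧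
`VHCAbelianSchemesRoad.TwistedPerfectDoor` ∧ reach ⟹ the Weil plane of every hyperbolic sixfold with `φ² = −(d+1)²d` is algebraic
(`d` even `≥ 4`) — Markman's Thm. 1.5.1 hyperbolic components, levels `(d+1)²d`, from the road's binders and print's pinned claim BY NAME.
[cite: Markman2025SecantWeil, Thm. 1.4.1, §1.5 and Thm. 1.5.1] [cite: Deligne1982HodgeCycles, §4 proof of Thm. 4.8] -/
theorem weilClasses_algebraic_hyperbolic_of_reach_of_twistedPerfectDoor_of_markmanPinned
    (hM : ∀ C : ChernCharacterBetti, Markman2025_secantQuotient_twistedCarrier_onJacobian_pinned C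
      (fun n X₀ I E => Summit.Ventures.HSemireg.gluableSigmaAdmissible n X₀ I E ∨
        Literature.AlgebraicGeometry.HodgeTheory.bfSingleAdmissible n X₀ I E))
    (hC : Theses.VHCAbelianSchemesRoad.ChernCharacterOnBetti) (hDoor : Theses.VHCAbelianSchemesRoad.TwistedPerfectDoor)
    (hF : weilFamilyReach_hyperbolic) {d : ℕ} (hd : Even d) (h4 : 4 ≤ d)
    (A : AbelianVariety ℂ) (φ : A ⟶ A) (hA : A.dim = 2 * 3) (hφ : φ ≫ φ = -(((d + 1) ^ 2 * d) • 𝟙 A))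
    (eA : ProjectiveEmbedding A.X) (aA : complexBetti (projectiveSpace eA.n ℂ) 2) (haA : IsRationalClass aA) (haA0 : aA ≠ 0)
    (hhypA : IsHyperbolicWeilType A φ 3
      ((((d + 1) ^ 2 * d : ℕ) : ℂ) • complexBetti.map eA.ι 2 aA + complexBetti.map φ.hom.hom.hom 2 (complexBetti.map eA.ι 2 aA))) :
    weilClassesOf A φ 3 ((d + 1) ^ 2 * d) ≤ algebraicClasses A.X 3 := by
  obtain ⟨C⟩ := (hC : Nonempty ChernCharacterBetti)
  exact weilClasses_algebraic_hyperbolic_of_reach_of_twistedPerfectDoorVHC_of_markmanPinned (hM C) (hDoor C) hF hd h4 A φ hA hφ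
    eA aA haA haA0 hhypA

end Rows

end Summit.HodgeConjecture.HodgeConjecture.Ring2.SemiregularRepresentatives

end
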